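import Summits.BirchSwinnertonDyer.BirchSwinnertonDyer.Theorems.Rank2Observatory2DescKillQuartic
import Mathlib.NumberTheory.Padics.RingHoms
import HarnessLib

/-!
# BirchSwinnertonDyer — SEL2CUBIC kill layer: the QUARTIC residue tree `qkCheck` in RESIDUE form and over `ℤ_p`

HONEST FRAMING: route `ShaPrimaryTransfer`, seat `bsd-line-spt-p1` (g32), `--supports` item T =
`FiniteShaComponentTransfer` (stmt-22356), UNCHANGED (conjecture-grade at corank ≥ 2). BSD in rank ≥ 2 is NOT
proved by any of this. THEOREMS ONLY.

The census "QK" kill layer (`Rank2Observatory2DescKillQuartic` / `…KillConic`, 291 census rows) certifies a binary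
quartic `Ĝ(u, v)` to be a non-square on `p`-primitive INTEGER pairs (`qkCheck_sound`: `Ĝ(u, v) ≠ m²`). A
`2`-Selmer class only supplies `p`-ADIC points (g30's `…SelmerCubicKillLocal`), so the Selmer reading of these rows
needs the tree's verdict in the two stronger currencies it actually establishes:

* `qdead_sound_mod`, `qnode_sound_mod`, **`qkCheck_sound_mod`** — RESIDUE form: if `qkCheck p g fuel = true` then no
  `p`-primitive integer pair `(u, v)` and integer `m` have `p^{fuel+1} ∣ Ĝ(u, v) − m²` (the proof of `qkCheck_sound`
  verbatim, the exact square replaced by the congruence it was only ever used for: a dead node at precision `p^k`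
  refutes `x ≡ m² (mod p^k)` for every `x ≡ N (mod p^k)`, `qdead_sound` applied to `x := m²`);
* **`quartEval_ne_mul_self_padicInt`** — `ℤ_p` form: no pair `(u, v) ∈ ℤ_p²` with a unit coordinate has `Ĝ(u, v) = μ²`,
  `μ ∈ ℤ_p` (reduce `u, v, μ` modulo `p^{fuel+1}` to integers, `PadicInt.toZModPow`);
* **`qk_no_square_padic`** — `ℚ_p` form of `qk_no_square`: `κ²·s²·Ĝ(u, v) = M²` with `κ, s ≠ 0`, `(u, v) ≠ 0` in `ℚ_p`
  is impossible (rescale `(u, v)` to a primitive `ℤ_p`-pair; `Ĝ` is homogeneous of degree `4`; a `p`-adic number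
  whose square is integral is integral).

Companion `…SelmerCubicKillQKPadic` feeds this with the `ℚ_p`-parametrisation of the class conic and turns the
resulting «no `ℚ_p`-zero of the quadric pair» into the residue statement the SEL2CUBIC doors consume.
[cite: CremonaAlgorithms1997, §3.6] [cite: Cassels1991LecturesEllipticCurves, §15]
-/

-- single-conjunct summit: `Summit.BirchSwinnertonDyer.BirchSwinnertonDyer.…` repeats the name by design
set_option linter.dupNamespace false

noncomputable section

namespace Summit.BirchSwinnertonDyer.BirchSwinnertonDyer.Theorems.ShaPrimaryTransferSelmerCubicKill

open Summit.BirchSwinnertonDyer.BirchSwinnertonDyer.Rank2Observatory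
open Summit.BirchSwinnertonDyer.BirchSwinnertonDyer.Rank2Observatory.TwoDescKill

/-! ## §1 The residue tree in residue form (integers) -/

/-- **Dead nodes, residue form**: if `qdead p N k = true` then no `x ≡ N (mod p^k)` is congruent to a square
modulo `p^k`. [cite: CremonaAlgorithms1997, §3.6] -/
theorem qdead_sound_mod {p : ℕ} (hp : p.Prime) {N : ℤ} {k : ℕ} (hd : qdead p N k = true) {x m : ℤ}
    (hx : (p : ℤ) ^ k ∣ x - N) (hm : (p : ℤ) ^ k ∣ x - m * m) : False := by
  refine qdead_sound hp hd (x := m * m) ?_ m rfl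
  have h := dvd_sub hx hm
  rwa [show x - N - (x - m * m) = m * m - N by ring] at h

/-- **Node soundness, residue form**: if `qnode p g A f w k = true` then no pair `(u, v)` congruent to the node
has `Ĝ(u, v) ≡ m² (mod p^{k+f})`. [cite: CremonaAlgorithms1997, §3.6] -/
theorem qnode_sound_mod {p : ℕ} (hp : p.Prime) (g : ℤ × ℤ × ℤ × ℤ × ℤ) (A : Bool) :
    ∀ (f : ℕ) (w : ℤ) (k : ℕ), qnode p g A f w k = true → ∀ u v : ℤ,
      (A = true → ((p ^ k : ℕ) : ℤ) ∣ u - w ∧ ((p ^ (k + f) : ℕ) : ℤ) ∣ v - 1) →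
      (A = false → ((p ^ (k + f) : ℕ) : ℤ) ∣ u - 1 ∧ ((p ^ k : ℕ) : ℤ) ∣ v - w) →
      ∀ m : ℤ, ¬ ((p ^ (k + f) : ℕ) : ℤ) ∣ quartEval g u v - m * m := by
  intro f
  induction f with
  | zero =>
      intro w k h u v hA hB m hm
      simp only [qnode] at h
      have hc : ((p ^ k : ℕ) : ℤ) ∣ quartEval g u v - qval g A w := by
        cases A
        · obtain ⟨hu, hv⟩ := hB rfl
          simpa [qval] using quartEval_congr g (p ^ k) (by simpa using hu) hv
        · obtain ⟨hu, hv⟩ := hA rfl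
          simpa [qval] using quartEval_congr g (p ^ k) hu (by simpa using hv)
      exact qdead_sound_mod hp h (by simpa using hc) (by simpa using hm)
  | succ f ih =>
      intro w k h u v hA hB m hm
      simp only [qnode, Bool.or_eq_true, List.all_eq_true, List.mem_range] at h
      have hpk : ((p ^ k : ℕ) : ℤ) ∣ ((p ^ (k + (f + 1)) : ℕ) : ℤ) :=
        Int.natCast_dvd_natCast.mpr (pow_dvd_pow p (by omega))
      rcases h with hd | hall
      · have hc : ((p ^ k : ℕ) : ℤ) ∣ quartEval g u v - qval g A w := by
          cases A
          · obtain ⟨hu, hv⟩ := hB rfl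
            simpa [qval] using quartEval_congr g (p ^ k) (hpk.trans hu) hv
          · obtain ⟨hu, hv⟩ := hA rfl
            simpa [qval] using quartEval_congr g (p ^ k) hu (hpk.trans hv)
        exact qdead_sound_mod hp hd (by simpa using hc) (by simpa using hpk.trans hm)
      · have hkf : k + 1 + f = k + (f + 1) := by ring
        cases A
        · obtain ⟨hu, hv⟩ := hB rfl
          obtain ⟨d, hd, e⟩ := exists_digit hp.pos (p ^ k) hv
          have e' : ((p ^ (k + 1) : ℕ) : ℤ) ∣ v - (w + (p : ℤ) ^ k * (d : ℤ)) := by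
            push_cast at e ⊢; rw [pow_succ]; exact e
          exact ih (w + (p : ℤ) ^ k * (d : ℤ)) (k + 1) (hall d hd) u v (fun h => by simp at h)
            (fun _ => ⟨by rw [hkf]; exact hu, e'⟩) m (by rw [hkf]; exact hm)
        · obtain ⟨hu, hv⟩ := hA rfl
          obtain ⟨d, hd, e⟩ := exists_digit hp.pos (p ^ k) hu
          have e' : ((p ^ (k + 1) : ℕ) : ℤ) ∣ u - (w + (p : ℤ) ^ k * (d : ℤ)) := by
            push_cast at e ⊢; rw [pow_succ]; exact e
          exact ih (w + (p : ℤ) ^ k * (d : ℤ)) (k + 1) (hall d hd) u v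
            (fun _ => ⟨e', by rw [hkf]; exact hv⟩) (fun h => by simp at h) m (by rw [hkf]; exact hm)

/-- **Soundness of the QK certificate, RESIDUE form**: if `qkCheck p g fuel = true` for a prime `p`, then no
integers `u, v, m` with `(u, v)` primitive at `p` have `p^{fuel+1} ∣ Ĝ(u, v) − m²`. [cite: CremonaAlgorithms1997, §3.6] -/
theorem qkCheck_sound_mod {p : ℕ} (hp : p.Prime) {g : ℤ × ℤ × ℤ × ℤ × ℤ} {fuel : ℕ}
    (h : qkCheck p g fuel = true) (u v m : ℤ) (hprim : ¬ ((p : ℤ) ∣ u ∧ (p : ℤ) ∣ v))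
    (he : (p : ℤ) ^ (fuel + 1) ∣ quartEval g u v - m * m) : False := by
  have hp0 : 0 < p := hp.pos
  have hpZ : Prime (p : ℤ) := Nat.prime_iff_prime_int.mp hp
  simp only [qkCheck, Bool.and_eq_true, List.all_eq_true, List.mem_range] at h
  obtain ⟨hcA, hcB⟩ := h
  have unit_of : ∀ w : ℤ, ¬ (p : ℤ) ∣ w → ∃ l t : ℤ, l * w + t * (p : ℤ) ^ (1 + fuel) = 1 := by
    intro w hw
    have hcop : IsCoprime w ((p : ℤ) ^ (1 + fuel)) :=
      ((Prime.coprime_iff_not_dvd hpZ).mpr hw).symm.pow_right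
    obtain ⟨l, t, hlt⟩ := hcop
    exact ⟨l, t, hlt⟩
  have digit : ∀ w : ℤ, ∃ d : ℕ, d < p ∧ (p : ℤ) ∣ w - d := by
    intro w
    have hp' : (0 : ℤ) < p := by exact_mod_cast hp0
    refine ⟨(w % (p : ℤ)).toNat, ?_, w / p, ?_⟩
    · have := Int.emod_lt_of_pos w hp'; have := Int.emod_nonneg w hp'.ne'; omega
    · rw [Int.toNat_of_nonneg (Int.emod_nonneg w hp'.ne')]
      linear_combination (-1 : ℤ) * Int.emod_add_ediv_mul w (p : ℤ)
  -- the scaled pair `(l u, l v)` has `G(lu, lv) − (l²m)² = l⁴ (G(u, v) − m²)`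
  have scaled : ∀ l : ℤ, ((p ^ (1 + fuel) : ℕ) : ℤ) ∣
      quartEval g (l * u) (l * v) - (l ^ 2 * m) * (l ^ 2 * m) := by
    intro l
    rw [quartEval_smul, show l ^ 4 * quartEval g u v - l ^ 2 * m * (l ^ 2 * m) =
      l ^ 4 * (quartEval g u v - m * m) by ring]
    push_cast
    rw [add_comm]
    exact dvd_mul_of_dvd_right he _
  by_cases hv : (p : ℤ) ∣ v
  · -- chart B: `p ∣ v`, so `p ∤ u`; scale `u` to `1`
    have hu : ¬ (p : ℤ) ∣ u := fun hu => hprim ⟨hu, hv⟩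
    obtain ⟨l, t, hlt⟩ := unit_of u hu
    refine qnode_sound_mod hp g false fuel 0 1 hcB (l * u) (l * v) (fun h => by simp at h)
      (fun _ => ⟨⟨-t, ?_⟩, ?_⟩) (l ^ 2 * m) (scaled l)
    · push_cast; linear_combination hlt
    · simpa using dvd_mul_of_dvd_right hv l
  · -- chart A: scale `v` to `1`, first digit of `l u`
    obtain ⟨l, t, hlt⟩ := unit_of v hv
    obtain ⟨d, hd, e⟩ := digit (l * u)
    refine qnode_sound_mod hp g true fuel (d : ℤ) 1 (hcA d hd) (l * u) (l * v)
      (fun _ => ⟨by simpa using e, ⟨-t, ?_⟩⟩) (fun h => by simp at h) (l ^ 2 * m) (scaled l)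
    push_cast; linear_combination hlt

/-! ## §2 The residue tree over `ℤ_p` and `ℚ_p` -/

section Padic

variable {p : ℕ} [Fact p.Prime]

/-- An element of `ℤ_p` is congruent modulo `p^M` to the integer lift of its residue. [folklore] -/
theorem toZModPow_intCast_val (M : ℕ) (x : ℤ_[p]) :
    PadicInt.toZModPow M (((PadicInt.toZModPow M x).val : ℤ) : ℤ_[p]) = PadicInt.toZModPow M x := by
  rw [map_intCast]
  simp only [Int.cast_natCast, ZMod.natCast_zmod_val]

/-- If `p` divides the integer lift of the residue of `x` modulo `p^M`, `M ≥ 1`, then `x` is not a unit.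
[folklore] -/
theorem norm_lt_one_of_dvd_val {M : ℕ} (hM : 1 ≤ M) {x : ℤ_[p]}
    (h : (p : ℤ) ∣ ((PadicInt.toZModPow M x).val : ℤ)) : ‖x‖ < 1 := by
  have hp : p.Prime := Fact.out
  set k : ℤ := ((PadicInt.toZModPow M x).val : ℤ)
  have h1 : ‖((k : ℤ) : ℤ_[p])‖ < 1 := (PadicInt.norm_int_lt_one_iff_dvd _).mpr h
  have h2 : ‖x - ((k : ℤ) : ℤ_[p])‖ < 1 := by
    have hk : x - ((k : ℤ) : ℤ_[p]) ∈ RingHom.ker (PadicInt.toZModPow M) := by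
      rw [RingHom.mem_ker, map_sub, toZModPow_intCast_val, sub_self]
    rw [PadicInt.ker_toZModPow, ← PadicInt.norm_le_pow_iff_mem_span_pow] at hk
    refine lt_of_le_of_lt hk ?_
    have hp1 : (1 : ℝ) < p := by exact_mod_cast hp.one_lt
    have : (p : ℝ) ^ (-(M : ℤ)) < (p : ℝ) ^ (0 : ℤ) := zpow_lt_zpow_right₀ hp1 (by omega)
    simpa using this
  have := PadicInt.nonarchimedean (x - ((k : ℤ) : ℤ_[p])) ((k : ℤ) : ℤ_[p])
  rw [sub_add_cancel] at this
  exact lt_of_le_of_lt this (max_lt h2 h1)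

/-- **The QK certificate over `ℤ_p`**: if `qkCheck p g fuel = true` then no pair `(u, v) ∈ ℤ_p²` with a unit
coordinate and no `μ ∈ ℤ_p` have `Ĝ(u, v) = μ²`. [cite: CremonaAlgorithms1997, §3.6] -/
theorem quartEval_ne_mul_self_padicInt {g : ℤ × ℤ × ℤ × ℤ × ℤ} {fuel : ℕ} (h : qkCheck p g fuel = true)
    (u v μ : ℤ_[p]) (hunit : ‖u‖ = 1 ∨ ‖v‖ = 1)
    (he : quartEval ((g.1 : ℤ_[p]), (g.2.1 : ℤ_[p]), (g.2.2.1 : ℤ_[p]), (g.2.2.2.1 : ℤ_[p]), (g.2.2.2.2 : ℤ_[p]))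
      u v = μ * μ) : False := by
  have hp : p.Prime := Fact.out
  set M : ℕ := fuel + 1 with hM
  set u₀ : ℤ := ((PadicInt.toZModPow M u).val : ℤ)
  set v₀ : ℤ := ((PadicInt.toZModPow M v).val : ℤ)
  set m₀ : ℤ := ((PadicInt.toZModPow M μ).val : ℤ)
  refine qkCheck_sound_mod hp h u₀ v₀ m₀ ?_ ?_
  · rintro ⟨hu, hv⟩
    have h1 := norm_lt_one_of_dvd_val (p := p) (by omega : 1 ≤ M) hu
    have h2 := norm_lt_one_of_dvd_val (p := p) (by omega : 1 ≤ M) hv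
    rcases hunit with e | e <;> linarith
  · rw [← PadicInt.norm_int_le_pow_iff_dvd, PadicInt.norm_le_pow_iff_mem_span_pow,
      ← PadicInt.ker_toZModPow, RingHom.mem_ker]
    have hq := map_quartEval (Int.castRingHom ℤ_[p]) g u₀ v₀
    simp only [eq_intCast] at hq
    push_cast
    rw [hq, map_sub, map_mul,
      map_quartEval (PadicInt.toZModPow M) ((g.1 : ℤ_[p]), (g.2.1 : ℤ_[p]), (g.2.2.1 : ℤ_[p]),
        (g.2.2.2.1 : ℤ_[p]), (g.2.2.2.2 : ℤ_[p])) (u₀ : ℤ_[p]) (v₀ : ℤ_[p]),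
      toZModPow_intCast_val, toZModPow_intCast_val, toZModPow_intCast_val,
      ← map_quartEval (PadicInt.toZModPow M), he, map_mul, sub_self]

/-- Rescaling a non-zero pair of `ℚ_p²` to a pair of `p`-adic integers with a unit coordinate. [folklore] -/
theorem exists_scale_primitive₂ (u v : ℚ_[p]) (h : ¬ (u = 0 ∧ v = 0)) :
    ∃ l : ℚ_[p], l ≠ 0 ∧ ‖l * u‖ ≤ 1 ∧ ‖l * v‖ ≤ 1 ∧ (‖l * u‖ = 1 ∨ ‖l * v‖ = 1) := by
  by_cases huv : ‖v‖ ≤ ‖u‖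
  · have hu : u ≠ 0 := by
      intro hu; rw [hu, norm_zero] at huv
      exact h ⟨hu, norm_le_zero_iff.mp huv⟩
    have hpos : 0 < ‖u‖ := norm_pos_iff.mpr hu
    refine ⟨u⁻¹, inv_ne_zero hu, ?_, ?_, Or.inl ?_⟩
    · rw [inv_mul_cancel₀ hu, norm_one]
    · rw [norm_mul, norm_inv, inv_mul_le_iff₀ hpos, mul_one]; exact huv
    · rw [inv_mul_cancel₀ hu, norm_one]
  · have hvu : ‖u‖ ≤ ‖v‖ := le_of_not_ge huv
    have hv : v ≠ 0 := by
      intro hv; rw [hv, norm_zero] at hvu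
      exact h ⟨norm_le_zero_iff.mp hvu, hv⟩
    have hpos : 0 < ‖v‖ := norm_pos_iff.mpr hv
    refine ⟨v⁻¹, inv_ne_zero hv, ?_, ?_, Or.inr ?_⟩
    · rw [norm_mul, norm_inv, inv_mul_le_iff₀ hpos, mul_one]; exact hvu
    · rw [inv_mul_cancel₀ hv, norm_one]
    · rw [inv_mul_cancel₀ hv, norm_one]

/-- **The QK certificate over `ℚ_p`** (`p`-adic form of `qk_no_square`): if `qkCheck p g fuel = true` then
`κ²·s²·Ĝ(u, v) = M²` is impossible in `ℚ_p` for `κ, s ≠ 0` and `(u, v) ≠ 0`. [cite: CremonaAlgorithms1997, §3.6] -/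
theorem qk_no_square_padic {g : ℤ × ℤ × ℤ × ℤ × ℤ} {fuel : ℕ} (hk : qkCheck p g fuel = true)
    {s κ u v M : ℚ_[p]} (hs : s ≠ 0) (hκ : κ ≠ 0) (huv : ¬ (u = 0 ∧ v = 0))
    (h : κ ^ 2 * (s ^ 2 * quartEval ((g.1 : ℚ_[p]), (g.2.1 : ℚ_[p]), (g.2.2.1 : ℚ_[p]), (g.2.2.2.1 : ℚ_[p]),
      (g.2.2.2.2 : ℚ_[p])) u v) = M * M) : False := by
  set gq : ℚ_[p] × ℚ_[p] × ℚ_[p] × ℚ_[p] × ℚ_[p] :=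
    ((g.1 : ℚ_[p]), (g.2.1 : ℚ_[p]), (g.2.2.1 : ℚ_[p]), (g.2.2.2.1 : ℚ_[p]), (g.2.2.2.2 : ℚ_[p])) with hgq
  obtain ⟨l, hl, hlu, hlv, hunit⟩ := exists_scale_primitive₂ u v huv
  -- the rescaled pair and its square root
  set μ : ℚ_[p] := l ^ 2 * M / (κ * s) with hμ
  have hks2 : (κ * s) ^ 2 ≠ 0 := pow_ne_zero _ (mul_ne_zero hκ hs)
  have hG : quartEval gq (l * u) (l * v) = μ * μ := by
    rw [quartEval_smul, hμ]
    symm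
    calc l ^ 2 * M / (κ * s) * (l ^ 2 * M / (κ * s)) = l ^ 4 * (M * M) / (κ * s) ^ 2 := by ring
      _ = l ^ 4 * ((κ * s) ^ 2 * quartEval gq u v) / (κ * s) ^ 2 := by
          rw [← h]; ring
      _ = l ^ 4 * quartEval gq u v := by
          rw [mul_comm ((κ * s) ^ 2) _, ← mul_assoc, mul_div_assoc, div_self hks2, mul_one]
  -- integrality of the value, hence of `μ`
  let u' : ℤ_[p] := ⟨l * u, hlu⟩
  let v' : ℤ_[p] := ⟨l * v, hlv⟩
  set gz : ℤ_[p] × ℤ_[p] × ℤ_[p] × ℤ_[p] × ℤ_[p] :=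
    ((g.1 : ℤ_[p]), (g.2.1 : ℤ_[p]), (g.2.2.1 : ℤ_[p]), (g.2.2.2.1 : ℤ_[p]), (g.2.2.2.2 : ℤ_[p])) with hgz
  have hcoe : ((quartEval gz u' v' : ℤ_[p]) : ℚ_[p]) = quartEval gq (l * u) (l * v) := by
    have hm := map_quartEval (PadicInt.Coe.ringHom (p := p)) gz u' v'
    have hC : ∀ x : ℤ_[p], PadicInt.Coe.ringHom x = (x : ℚ_[p]) := fun x => rfl
    simp only [hC, hgz, PadicInt.coe_intCast] at hm
    rw [hm]
  have hμ1 : ‖μ‖ ≤ 1 := by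
    have h2 : ‖μ‖ * ‖μ‖ ≤ 1 := by
      rw [← norm_mul, ← hG, ← hcoe]; exact (quartEval gz u' v').2
    by_contra hlt
    push Not at hlt
    nlinarith [norm_nonneg μ]
  let μ' : ℤ_[p] := ⟨μ, hμ1⟩
  have hG' : quartEval gz u' v' = μ' * μ' := by
    apply Subtype.ext
    show ((quartEval gz u' v' : ℤ_[p]) : ℚ_[p]) = ((μ' * μ' : ℤ_[p]) : ℚ_[p])
    rw [hcoe, hG, PadicInt.coe_mul]
  have hunit' : ‖u'‖ = 1 ∨ ‖v'‖ = 1 := by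
    simpa only [u', v', PadicInt.norm_def] using hunit
  exact quartEval_ne_mul_self_padicInt hk u' v' μ' hunit' hG'

end Padic

end Summit.BirchSwinnertonDyer.BirchSwinnertonDyer.Theorems.ShaPrimaryTransferSelmerCubicKill

end
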